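import Mathlib
import Summits.Ventures.HodgeRepro2.T5FiltrationHilbert90
import Summits.Ventures.HodgeRepro2.T5HigherUnitsIndex

/-!
# `|E¹/(E¹ ∩ U^n)| = [U_E : U_F U_E^n]` — the three numbers of N5.15.2 (A15)

N5.T3 (l. 450) and N5.15.2 use, at an inert place `w` (`E_w/F_w` unramified quadratic, `σ` the
non-trivial automorphism, `j(x) = x/σx`): `|E¹_w/(E¹_w ∩ U²_{E_w})| = (q_w+1)q_w`, `|G¹| = q_w`,
`G/G¹ ≅ k^{N=1}` of order `q_w + 1`. The print proof (Cassels–Fröhlich Ch. IV §8 + Ch. VI §1.2)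
gives Hilbert 90 along the filtration; the COUNT then is pure group theory:

  `E¹ = j(U_E)` (Hilbert 90 at level 0), `E¹ ∩ U^n = j(U^n)` (`T5FiltrationHilbert90`),
  `ker j = U_F` (the fixed points of `σ` on an unramified integral basis `S = R ⊕ Rθ`),
  hence `[E¹ : E¹ ∩ U^n] = [j(U_E) : j(U^n)] = [U_E : U^n ⊔ ker j] = [U_E : U_F U^n]`
  (`Subgroup.relIndex_map_map`), `= (q+1)q^{n-1}` (`T5HigherUnitsIndex.index_sup_eq_of_card`).

* `relIndex_map_range`: `[f(G) : f(W)] = [G : W ⊔ ker f]` for any homomorphism;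
* `ker_conjQuotHom`: `ker j = U_F` (image of `Rˣ`);
* `mem_range_conjQuotHom_iff`: under Hilbert 90 at level 0, `E¹ = {z ∣ σz = z⁻¹}` is the range of `j`;
* `range_inf_higherUnits_eq_map`: `E¹ ∩ U^n = j(U^n)`;
* `relIndex_range_inf_higherUnits`: `[E¹ : E¹ ∩ U^n] = [U_E : U_F U_E^n]`;
* `relIndex_range_inf_higherUnits_eq`, `…_two`, `…_one`, `relIndex_inf_two_inf_one`: the numbers
  `(q+1)q^{n-1}`, `(q+1)q`, `q+1`, and `|G¹| = [E¹ ∩ U¹ : E¹ ∩ U²] = q`.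

Hilbert 90 at level 0 (`∀ z, σz = z⁻¹ → ∃ x, j x = z`) stays a HYPOTHESIS here, as in
`T5FiltrationHilbert90` (it is the content of Ĥ⁻¹(G, E^×) = 0 / Ch. IV §8 in print).

Declaration per README §8(d): «uses an L-value-free non-vanishing device: NO».
-/

namespace Summit.Ventures.HodgeRepro2.T5NormOneQuotientOrder

open T5PrincipalUnitFiltration T5PrincipalUnitComparison T5FiltrationHilbert90

section Abstract

variable {G H : Type*} [Group G] [Group H]

/-- `[f(G) : f(W)] = [G : W ⊔ ker f]`. -/
theorem relIndex_map_range (f : G →* H) (W : Subgroup G) :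
    (W.map f).relIndex f.range = (W ⊔ f.ker).index := by
  rw [MonoidHom.range_eq_map, Subgroup.relIndex_map_map, top_sup_eq, Subgroup.relIndex_top_right]

end Abstract

section Ring

variable {R S : Type*} [CommRing R] [CommRing S] [Algebra R S] (σ : S ≃+* S)

/-- `j` as a homomorphism `Sˣ →* Sˣ` (`conjQuot_mul`). -/
theorem conjQuotHom_apply (x : Sˣ) : MonoidHom.mk' (conjQuot σ) (conjQuot_mul σ) x = conjQuot σ x :=
  rfl

/-- `σ` is an involution on units. -/
theorem conjUnits_conjUnits (hinv : ∀ s, σ (σ s) = s) (x : Sˣ) :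
    conjUnits σ (conjUnits σ x) = x := by
  apply Units.ext
  simp only [conjUnits, Units.coe_map]
  exact hinv _

/-- `j x` is a norm-one unit: `σ (j x) = (j x)⁻¹` (`σ` an involution). -/
theorem conjUnits_conjQuot (hinv : ∀ s, σ (σ s) = s) (x : Sˣ) :
    conjUnits σ (conjQuot σ x) = (conjQuot σ x)⁻¹ := by
  simp only [conjQuot]
  rw [map_mul, map_inv, conjUnits_conjUnits σ hinv, mul_inv_rev, inv_inv]

/-- Under Hilbert 90 at level 0, `E¹ = {z ∣ σz = z⁻¹}` IS the range of `j`. -/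
theorem mem_range_conjQuotHom_iff (hinv : ∀ s, σ (σ s) = s)
    (hH90 : ∀ z : Sˣ, conjUnits σ z = z⁻¹ → ∃ x, conjQuot σ x = z) (z : Sˣ) :
    z ∈ (MonoidHom.mk' (conjQuot σ) (conjQuot_mul σ)).range ↔ conjUnits σ z = z⁻¹ := by
  rw [MonoidHom.mem_range]
  constructor
  · rintro ⟨x, rfl⟩
    exact conjUnits_conjQuot σ hinv x
  · exact hH90 z

variable [IsLocalHom (algebraMap R S)]

/-- THE KERNEL OF `j` IS `U_F`: on an unramified integral basis `S = R ⊕ Rθ` with `θ − σθ` a unit,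
a unit fixed by `σ` lies in the image of `Rˣ`. -/
theorem ker_conjQuotHom (hσ : ∀ r : R, σ (algebraMap R S r) = algebraMap R S r) {θ : S}
    (hθ : IsUnit (θ - σ θ)) (hbasis : ∀ s : S, ∃ a b, s = algebraMap R S a + algebraMap R S b * θ) :
    (MonoidHom.mk' (conjQuot σ) (conjQuot_mul σ)).ker =
      (unitsMap (R := R) (S := S)).range := by
  ext x
  rw [MonoidHom.mem_ker, conjQuotHom_apply, MonoidHom.mem_range]
  constructor
  · intro hx
    -- `σ x = x`
    have hfix : σ (x : S) = x := by
      have h1 : x * (conjUnits σ x)⁻¹ = 1 := hx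
      rw [mul_inv_eq_one] at h1
      have h2 := congrArg Units.val h1
      rw [Units.coe_map] at h2
      exact h2.symm
    obtain ⟨a, b, hab⟩ := hbasis x
    have h3 : algebraMap R S b * (θ - σ θ) = 0 := by
      have h4 := hfix
      rw [hab, map_add, map_mul, hσ, hσ] at h4
      linear_combination (-1 : S) * h4
    have hb : algebraMap R S b = 0 := (IsUnit.mul_left_eq_zero hθ).mp h3
    have hxa : (x : S) = algebraMap R S a := by rw [hab, hb, zero_mul, add_zero]
    have ha : IsUnit a := isUnit_of_map_unit (algebraMap R S) a (hxa ▸ x.isUnit)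
    refine ⟨ha.unit, Units.ext ?_⟩
    rw [hxa]
    rfl
  · rintro ⟨a, rfl⟩
    exact conjQuot_unitsMap σ hσ a

variable [IsLocalRing S]

/-- `E¹ ∩ U^n = j(U^n)` (`T5FiltrationHilbert90` in both directions). -/
theorem range_inf_higherUnits_eq_map (hσ : ∀ r : R, σ (algebraMap R S r) = algebraMap R S r)
    (hinv : ∀ s, σ (σ s) = s) {θ : S} (hθ : IsUnit (θ - σ θ))
    (hbasis : ∀ s : S, ∃ a b, s = algebraMap R S a + algebraMap R S b * θ) {ϖ : R}
    (hϖ : algebraMap R S ϖ ∈ IsLocalRing.maximalIdeal S)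
    (hH90 : ∀ z : Sˣ, conjUnits σ z = z⁻¹ → ∃ x, conjQuot σ x = z) (n : ℕ) :
    (MonoidHom.mk' (conjQuot σ) (conjQuot_mul σ)).range ⊓ higherUnits (algebraMap R S ϖ) n =
      (higherUnits (algebraMap R S ϖ) n).map (MonoidHom.mk' (conjQuot σ) (conjQuot_mul σ)) := by
  ext z
  rw [Subgroup.mem_inf, mem_range_conjQuotHom_iff σ hinv hH90, Subgroup.mem_map]
  constructor
  · rintro ⟨hz, hzn⟩
    exact exists_mem_higherUnits_conjQuot_eq σ hσ hθ hbasis hϖ hH90 n z hz hzn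
  · rintro ⟨x, hx, rfl⟩
    exact ⟨conjUnits_conjQuot σ hinv x, (conjQuot_mem_higherUnits σ hσ hinv hx).1⟩

/-- `[E¹ : E¹ ∩ U^n] = [U_E : U_F U_E^n]`. -/
theorem relIndex_range_inf_higherUnits (hσ : ∀ r : R, σ (algebraMap R S r) = algebraMap R S r)
    (hinv : ∀ s, σ (σ s) = s) {θ : S} (hθ : IsUnit (θ - σ θ))
    (hbasis : ∀ s : S, ∃ a b, s = algebraMap R S a + algebraMap R S b * θ) {ϖ : R}
    (hϖ : algebraMap R S ϖ ∈ IsLocalRing.maximalIdeal S)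
    (hH90 : ∀ z : Sˣ, conjUnits σ z = z⁻¹ → ∃ x, conjQuot σ x = z) (n : ℕ) :
    ((MonoidHom.mk' (conjQuot σ) (conjQuot_mul σ)).range ⊓ higherUnits (algebraMap R S ϖ) n).relIndex
      (MonoidHom.mk' (conjQuot σ) (conjQuot_mul σ)).range =
      ((unitsMap (R := R) (S := S)).range ⊔ higherUnits (algebraMap R S ϖ) n).index := by
  rw [range_inf_higherUnits_eq_map σ hσ hinv hθ hbasis hϖ hH90 n, relIndex_map_range,
    ker_conjQuotHom σ hσ hθ hbasis, sup_comm]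

end Ring

section DVR

variable {R S : Type*} [CommRing R] [CommRing S] [Algebra R S] [IsDomain R] [IsDomain S]
  [IsDiscreteValuationRing R] [IsDiscreteValuationRing S] [IsLocalHom (algebraMap R S)]
  (σ : S ≃+* S) (hσ : ∀ r : R, σ (algebraMap R S r) = algebraMap R S r)
  (hinv : ∀ s, σ (σ s) = s) {θ : S} (hθ : IsUnit (θ - σ θ))
  (hbasis : ∀ s : S, ∃ a b, s = algebraMap R S a + algebraMap R S b * θ)
  (hinj : Function.Injective (algebraMap R S)) {ϖ : R} (hϖ : Irreducible ϖ)
  (hϖS : Irreducible (algebraMap R S ϖ))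
  (hH90 : ∀ z : Sˣ, conjUnits σ z = z⁻¹ → ∃ x, conjQuot σ x = z)
  {q : ℕ} (hq : 2 ≤ q) (hk : Nat.card (IsLocalRing.ResidueField R) = q)
  (hku : Nat.card (IsLocalRing.ResidueField R)ˣ = q - 1)
  (hK : Nat.card (IsLocalRing.ResidueField S) = q ^ 2)
  (hKu : Nat.card (IsLocalRing.ResidueField S)ˣ = q ^ 2 - 1)

include hσ hinv hθ hbasis hinj hϖ hϖS hH90 hq hk hku hK hKu

/-- THE NUMBER `|E¹/(E¹ ∩ U^n)| = (q+1)·q^{n-1}` (`n ≥ 1`). -/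
theorem relIndex_range_inf_higherUnits_eq {n : ℕ} (hn : 1 ≤ n) :
    ((MonoidHom.mk' (conjQuot σ) (conjQuot_mul σ)).range ⊓ higherUnits (algebraMap R S ϖ) n).relIndex
      (MonoidHom.mk' (conjQuot σ) (conjQuot_mul σ)).range = (q + 1) * q ^ (n - 1) := by
  have hϖm : algebraMap R S ϖ ∈ IsLocalRing.maximalIdeal S :=
    (IsLocalRing.mem_maximalIdeal _).mpr (mem_nonunits_iff.mpr hϖS.not_isUnit)
  rw [relIndex_range_inf_higherUnits σ hσ hinv hθ hbasis hϖm hH90 n,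
    T5HigherUnitsIndex.index_sup_eq_of_card hinj hϖ hϖS hn hq hk hku hK hKu]

/-- N5.15.2 / N5.T3 l. 450: `|E¹_w/(E¹_w ∩ U²_{E_w})| = (q_w+1)·q_w`. -/
theorem relIndex_range_inf_higherUnits_two :
    ((MonoidHom.mk' (conjQuot σ) (conjQuot_mul σ)).range ⊓ higherUnits (algebraMap R S ϖ) 2).relIndex
      (MonoidHom.mk' (conjQuot σ) (conjQuot_mul σ)).range = (q + 1) * q := by
  rw [relIndex_range_inf_higherUnits_eq σ hσ hinv hθ hbasis hinj hϖ hϖS hH90 hq hk hku hK hKu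
    one_le_two]
  norm_num

/-- `|G/G¹| = |E¹/(E¹ ∩ U¹)| = q + 1` (the norm-one elements of `k_E^×`). -/
theorem relIndex_range_inf_higherUnits_one :
    ((MonoidHom.mk' (conjQuot σ) (conjQuot_mul σ)).range ⊓ higherUnits (algebraMap R S ϖ) 1).relIndex
      (MonoidHom.mk' (conjQuot σ) (conjQuot_mul σ)).range = q + 1 := by
  rw [relIndex_range_inf_higherUnits_eq σ hσ hinv hθ hbasis hinj hϖ hϖS hH90 hq hk hku hK hKu
    le_rfl, Nat.sub_self, pow_zero, mul_one]

/-- `|G¹| = [E¹ ∩ U¹ : E¹ ∩ U²] = q`. -/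
theorem relIndex_inf_two_inf_one :
    ((MonoidHom.mk' (conjQuot σ) (conjQuot_mul σ)).range ⊓ higherUnits (algebraMap R S ϖ) 2).relIndex
      ((MonoidHom.mk' (conjQuot σ) (conjQuot_mul σ)).range ⊓ higherUnits (algebraMap R S ϖ) 1) =
      q := by
  have h := Subgroup.relIndex_mul_relIndex
    ((MonoidHom.mk' (conjQuot σ) (conjQuot_mul σ)).range ⊓ higherUnits (algebraMap R S ϖ) 2)
    ((MonoidHom.mk' (conjQuot σ) (conjQuot_mul σ)).range ⊓ higherUnits (algebraMap R S ϖ) 1)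
    (MonoidHom.mk' (conjQuot σ) (conjQuot_mul σ)).range
    (inf_le_inf_left _ (higherUnits_succ_le _ 1)) inf_le_left
  rw [relIndex_range_inf_higherUnits_one σ hσ hinv hθ hbasis hinj hϖ hϖS hH90 hq hk hku hK hKu,
    relIndex_range_inf_higherUnits_two σ hσ hinv hθ hbasis hinj hϖ hϖS hH90 hq hk hku hK hKu,
    mul_comm (q + 1) q] at h
  exact Nat.eq_of_mul_eq_mul_right (by omega) h

end DVR


end Summit.Ventures.HodgeRepro2.T5NormOneQuotientOrder
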